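import Summits.QuantumFields.YangMills.Theorems.LuscherReductionTwistedTraceScalingRecordWeightRho
import HarnessLib

/-!
# The SUPPORT-SEPARATED tube currency: weight `χ` on a big tube, test functions supported in a smaller invariant region `S` (COARSE-DESIGN §24.3, the region fix of record)
# (lane A of S-BASE, crux `TwistedTraceScaling` stmt-QuantumFields-20203, C4 INNER)

With `χ = recordWeightRho δ ρ δg` the tube test functions AND the Born–Oppenheimer functions must live in `supp χ ⊆ {orbitDist < δ}`; near the edge of that orbit-distance cut the BO
fibres are truncated in a slow boundary layer (COARSE-DESIGN §24.3), where the STIFF clause with an `O(1)` gap is false along the abelian valley.  The cheap fix: keep the weight on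
a BIG tube (`χ_big = recordWeightRho δ_big ρ δg`, `δ_big ≥ δ`) and restrict only the TEST functions to `S β = {orbitDist < δ β}`; the split `f = u + v` of the package is free to
live anywhere in `supp χ_big`.  THIS FILE types the two support-separated targets and re-proves the reductions verbatim:
* `SoftTubeNoIntruderOn L χ S`, `SoftTubeBOPackageOn L χ S` — as `SoftTubeNoIntruderAt` / `SoftTubeBOPackageAt` with the extra hypothesis `f i U ≠ 0 → U ∈ S β`;
* `softTubeAdmissible_mono` — admissibility at a radius is admissibility at every smaller radius;
* ★★★ `innerNoIntruderOneOrbitAt_of_softTubeOn : SoftTubeAdmissible L δ χ → SoftTubeNoIntruderOn L χ (fun β ↦ {orbitDist < δ β}) → InnerNoIntruderOneOrbitAt L δ`;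
* ★★★ `softTubeNoIntruderOn_of_package : SoftTubeBOPackageOn L χ S → SoftTubeNoIntruderOn L χ S` (Feshbach endgame verbatim);
* ★★★ `innerNoIntruderOneOrbitAt_of_bigRecordWeight_packageOn` — the instance of record: `χ_big = recordWeightRho δ' ρ δg` with `δ ≤ δ'`, `2δ' ≤ ρ`, test support `{orbitDist < δ}`;
  and its power-scale form `innerNoIntruderOneOrbitAt_pow_of_bigRecordWeight_packageOn` (`δ = β^{-s}`, `δ' = 3β^{-s}`, `ρ = Mβ^{-s}`, `M ≥ 6`, `δg = β^{-t}`).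
HONEST FRAMING: typed reductions (bookkeeping) for a stub of a child of the CONDITIONAL reduction route R2b1; the package is OPEN; not infinite volume, not a gap, not Clay.
-/

set_option autoImplicit false

noncomputable section

open MeasureTheory Filter Topology Real
open scoped BigOperators
open Literature.MathematicalPhysics.QuantumFieldTheory
open Literature.MathematicalPhysics.QuantumLattice

namespace Summit.QuantumFields.YangMills.Theorems.FemtoTransferGap

open TwoLattice.Avg TwoLattice.ConstTube

variable {L : ℕ} [NeZero L]

/-! ## §1 The support-separated targets -/

variable (L) in
/-- **SOFT TUBE NO-INTRUDER with separated support** (target text; OPEN): as `SoftTubeNoIntruderAt L χ`, for families supported in `supp (χ β) ∩ S β`. [cite: Luscher1983, §3] -/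
def SoftTubeNoIntruderOn (χ : ℝ → GaugeConfig 3 L SU2 → ℝ) (S : ℝ → Set (GaugeConfig 3 L SU2)) : Prop :=
  ∀ k : ℕ, ∀ ε : ℝ, 0 < ε → ∃ β0 : ℝ, ∀ β : ℝ, β0 ≤ β →
    ∀ f : Fin (k + 1) → (GaugeConfig 3 L SU2 → ℝ),
      (∀ i, Measurable (f i)) → (∀ i, ∃ C : ℝ, ∀ U, |f i U| ≤ C) → (∀ i U, f i U ≠ 0 → χ β U ≠ 0) → (∀ i U, f i U ≠ 0 → U ∈ S β) →
      (∀ a : Fin (k + 1) → ℝ, a ≠ 0 → 0 < ∫ U, (∑ i, a i * f i U) ^ 2 * softWeight (χ β) U ∂configMeasure SU2 L) →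
        ∃ a : Fin (k + 1) → ℝ, a ≠ 0 ∧
          (∫ U, ∫ V, (∑ i, a i * f i U) * avgKernel β U V * (∑ i, a i * f i V) ∂configMeasure SU2 L ∂configMeasure SU2 L) *
              levelValue su2Rep 1 ((L : ℝ) ^ 3 * β) 0 ≤
            Real.exp (ε * bareLambda ((L : ℝ) ^ 3 * β)) * levelValue su2Rep 1 ((L : ℝ) ^ 3 * β) k * levelValue su2Rep L β 0 *
              ∫ U, (∑ i, a i * f i U) ^ 2 * softWeight (χ β) U ∂configMeasure SU2 L

variable (L) in
/-- **THE BO PACKAGE with separated support** (OPEN): the clauses of `SoftTubeBOPackageAt L χ` for admissible families supported in `supp (χ β) ∩ S β`; the split `u, v` is free.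
[cite: Luscher1983, §3] [cite: SjostrandZworski2007, §2] -/
def SoftTubeBOPackageOn (χ : ℝ → GaugeConfig 3 L SU2 → ℝ) (S : ℝ → Set (GaugeConfig 3 L SU2)) : Prop :=
  ∀ k : ℕ, ∀ ε : ℝ, 0 < ε → ∃ θ : ℝ, 0 < θ ∧ θ ≤ 1 ∧ ∃ β0 : ℝ, ∀ β : ℝ, β0 ≤ β →
    ∃ σ b : ℝ, 0 < σ ∧ 0 ≤ b ∧ b ^ 2 ≤ ε * θ * bareLambda ((L : ℝ) ^ 3 * β) / 16 ∧
      Real.exp (-(ε / 4 * bareLambda ((L : ℝ) ^ 3 * β))) * (σ * levelValue su2Rep 1 ((L : ℝ) ^ 3 * β) 0) ≤ levelValue su2Rep L β 0 ∧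
      ∀ f : Fin (k + 1) → (GaugeConfig 3 L SU2 → ℝ),
        (∀ i, Measurable (f i)) → (∀ i, ∃ C : ℝ, ∀ U, |f i U| ≤ C) → (∀ i U, f i U ≠ 0 → χ β U ≠ 0) → (∀ i U, f i U ≠ 0 → U ∈ S β) →
        (∀ a : Fin (k + 1) → ℝ, a ≠ 0 → 0 < tubeNormSq (softWeight (χ β)) (fun U => ∑ i, a i * f i U)) →
          ∃ u v : Fin (k + 1) → (GaugeConfig 3 L SU2 → ℝ),
            (∀ a : Fin (k + 1) → ℝ,
              0 ≤ tubeNormSq (softWeight (χ β)) (fun U => ∑ i, a i * u i U) ∧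
              0 ≤ tubeNormSq (softWeight (χ β)) (fun U => ∑ i, a i * v i U) ∧
              tubeNormSq (softWeight (χ β)) (fun U => ∑ i, a i * u i U) + tubeNormSq (softWeight (χ β)) (fun U => ∑ i, a i * v i U) ≤
                tubeNormSq (softWeight (χ β)) (fun U => ∑ i, a i * f i U) ∧
              tubeForm β (fun U => ∑ i, a i * v i U) ≤
                (1 - θ) * (σ * levelValue su2Rep 1 ((L : ℝ) ^ 3 * β) 0) * tubeNormSq (softWeight (χ β)) (fun U => ∑ i, a i * v i U) ∧
              tubeForm β (fun U => ∑ i, a i * f i U) ≤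
                tubeForm β (fun U => ∑ i, a i * u i U) +
                  2 * (b * (σ * levelValue su2Rep 1 ((L : ℝ) ^ 3 * β) 0)) *
                    Real.sqrt (tubeNormSq (softWeight (χ β)) (fun U => ∑ i, a i * u i U)) *
                    Real.sqrt (tubeNormSq (softWeight (χ β)) (fun U => ∑ i, a i * v i U)) +
                  tubeForm β (fun U => ∑ i, a i * v i U)) ∧
            ∃ a : Fin (k + 1) → ℝ, a ≠ 0 ∧
              tubeForm β (fun U => ∑ i, a i * u i U) ≤
                Real.exp (ε / 4 * bareLambda ((L : ℝ) ^ 3 * β)) * (σ * levelValue su2Rep 1 ((L : ℝ) ^ 3 * β) k) *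
                  tubeNormSq (softWeight (χ β)) (fun U => ∑ i, a i * u i U)

/-- The unrestricted statement is the one with `S = univ`. [folklore] -/
theorem softTubeNoIntruderOn_univ_iff (χ : ℝ → GaugeConfig 3 L SU2 → ℝ) :
    SoftTubeNoIntruderOn L χ (fun _ => Set.univ) ↔ SoftTubeNoIntruderAt L χ := by
  unfold SoftTubeNoIntruderOn SoftTubeNoIntruderAt
  constructor
  · intro h k ε hε
    obtain ⟨β0, hβ0⟩ := h k ε hε
    exact ⟨β0, fun β hβ f hm hb hs hG => hβ0 β hβ f hm hb hs (fun _ _ _ => Set.mem_univ _) hG⟩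
  · intro h k ε hε
    obtain ⟨β0, hβ0⟩ := h k ε hε
    exact ⟨β0, fun β hβ f hm hb hs _ hG => hβ0 β hβ f hm hb hs hG⟩

/-- A statement for a larger admissible support set implies the one for a smaller set. [folklore] -/
theorem SoftTubeNoIntruderOn.mono {χ : ℝ → GaugeConfig 3 L SU2 → ℝ} {S S' : ℝ → Set (GaugeConfig 3 L SU2)} (hSS' : ∀ β, S β ⊆ S' β)
    (h : SoftTubeNoIntruderOn L χ S') : SoftTubeNoIntruderOn L χ S := by
  intro k ε hε
  obtain ⟨β0, hβ0⟩ := h k ε hε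
  exact ⟨β0, fun β hβ f hm hb hs hS hG => hβ0 β hβ f hm hb hs (fun i U hU => hSS' β (hS i U hU)) hG⟩

/-- Admissibility at a radius is admissibility at every smaller radius. [folklore] -/
theorem softTubeAdmissible_mono {δ δ' : ℝ → ℝ} {χ : ℝ → GaugeConfig 3 L SU2 → ℝ} (hle : ∀ β, δ β ≤ δ' β) (h : SoftTubeAdmissible L δ' χ) :
    SoftTubeAdmissible L δ χ := by
  obtain ⟨hm, hb, β1, hβ1⟩ := h
  refine ⟨hm, hb, β1, fun β hβ => ?_⟩
  obtain ⟨hcov, n₀, hn₀, hlow⟩ := hβ1 β hβ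
  exact ⟨fun U hU => hcov U (hU.trans_le (hle β)), n₀, hn₀, hlow⟩

/-! ## §2 ★★★ C4 INNER ONE-ORBIT from the support-separated soft tube statement -/

/-- ★★★ **C4 INNER ONE-ORBIT ⇐ the soft tube statement for test functions supported in `{orbitDist < δ}`** (weight admissible at radius `δ`; its support may be larger).
Proof = `innerNoIntruderOneOrbitAt_of_softTube` verbatim: the slice function `f = Gχ/N` of a `G` supported in `{orbitDist < δ}` is supported there. [cite: Luscher1983, §3] -/
theorem innerNoIntruderOneOrbitAt_of_softTubeOn {δ : ℝ → ℝ} {χ : ℝ → GaugeConfig 3 L SU2 → ℝ} (hT : SoftTubeAdmissible L δ χ)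
    (hN : SoftTubeNoIntruderOn L χ (fun β => {U | orbitDist U < δ β})) : InnerNoIntruderOneOrbitAt L δ := by
  obtain ⟨hχm, hχb, β1, hβ1⟩ := hT
  intro k ε hε
  obtain ⟨β0, hβ0⟩ := hN k ε hε
  refine ⟨max β0 β1, fun β hβ G hGm hGb hGinv hGsupp hGind => ?_⟩
  have hβ0' : β0 ≤ β := (le_max_left _ _).trans hβ
  obtain ⟨hcov, n₀, hn₀, hNlow⟩ := hβ1 β ((le_max_right _ _).trans hβ)
  obtain ⟨Cχ, hCχ⟩ := hχb β
  set f : Fin (k + 1) → GaugeConfig 3 L SU2 → ℝ := fun i => sliceFn (χ β) (G i) with hf_def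
  have hψ : ∀ a : Fin (k + 1) → ℝ,
      Measurable (fun U => ∑ i, a i * G i U) ∧ (∃ C : ℝ, ∀ U, |∑ i, a i * G i U| ≤ C) ∧
        (∀ (g : Site 3 L → SU2) (U : GaugeConfig 3 L SU2), (∑ i, a i * G i (gaugeTransform g U)) = ∑ i, a i * G i U) ∧
        (∀ U, (∑ i, a i * G i U) ≠ 0 → gaugeAvg (χ β) U ≠ 0) := fun a =>
    ⟨measurable_combination hGm a, bounded_combination hGb a, invariant_combination hGinv a, fun U hU => by
      obtain ⟨i, hi⟩ := exists_ne_zero_of_combination_ne_zero hU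
      exact (hcov U (hGsupp i U hi)).ne'⟩
  have hslice : ∀ a : Fin (k + 1) → ℝ, sliceFn (χ β) (fun U => ∑ i, a i * G i U) = fun U => ∑ i, a i * f i U := fun a => sliceFn_sum (χ β) a G
  have hpack : ∀ a : Fin (k + 1) → ℝ,
      l2 (fun U => ∑ i, a i * G i U) (fun U => ∑ i, a i * G i U) = ∫ U, (∑ i, a i * f i U) ^ 2 * softWeight (χ β) U ∂configMeasure SU2 L ∧
      qform su2Rep β (fun U => ∑ i, a i * G i U) (fun U => ∑ i, a i * G i U) =
        ∫ U, ∫ V, (∑ i, a i * f i U) * avgKernel β U V * (∑ i, a i * f i V) ∂configMeasure SU2 L ∂configMeasure SU2 L := fun a => by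
    obtain ⟨hm, ⟨C, hC⟩, hinv, hcv⟩ := hψ a
    have h1 := qform_eq_integral_avgKernel β (hχm β) hCχ hn₀ hNlow hm hC hinv hcv hm hC hinv hcv
    have h2 := l2_eq_sliceFn_left (hχm β) hCχ hn₀ hNlow hm hC hinv hcv hm hC hinv
    rw [hslice a] at h1 h2
    refine ⟨?_, h1⟩
    rw [h2]
    unfold l2
    refine integral_congr_ae (ae_of_all _ fun U => ?_)
    have h3 := sliceFn_mul_self_eq (ψ := fun U => ∑ i, a i * G i U) hn₀ hNlow U
    rw [hslice a] at h3
    exact h3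
  have hfm : ∀ i, Measurable (f i) := fun i => measurable_sliceFn (hχm β) (hGm i)
  have hfb : ∀ i, ∃ C : ℝ, ∀ U, |f i U| ≤ C := fun i => by
    obtain ⟨C, hC⟩ := hGb i
    exact ⟨C * Cχ / n₀, abs_sliceFn_le hCχ hC hn₀ hNlow⟩
  have hfsupp : ∀ i U, f i U ≠ 0 → χ β U ≠ 0 := fun i U hU => (sliceFn_ne_zero hU).1
  have hfS : ∀ i U, f i U ≠ 0 → U ∈ {U : GaugeConfig 3 L SU2 | orbitDist U < δ β} := fun i U hU => hGsupp i U (sliceFn_ne_zero hU).2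
  have hfind : ∀ a : Fin (k + 1) → ℝ, a ≠ 0 → 0 < ∫ U, (∑ i, a i * f i U) ^ 2 * softWeight (χ β) U ∂configMeasure SU2 L := fun a ha => by
    rw [← (hpack a).1]; exact hGind a ha
  obtain ⟨a, ha, hle⟩ := hβ0 β hβ0' f hfm hfb hfsupp hfS hfind
  refine ⟨a, ha, ?_⟩
  rw [(hpack a).2, (hpack a).1]
  exact hle

/-! ## §3 ★★★ The support-separated tube statement from the support-separated package -/

/-- ★★★ `SoftTubeBOPackageOn L χ S → SoftTubeNoIntruderOn L χ S` (Feshbach endgame `feshbach_endgame`, proof of `softTubeNoIntruderAt_of_package` verbatim).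
[cite: Luscher1983, §3] [cite: SjostrandZworski2007, §2] -/
theorem softTubeNoIntruderOn_of_package {χ : ℝ → GaugeConfig 3 L SU2 → ℝ} {S : ℝ → Set (GaugeConfig 3 L SU2)} (hP : SoftTubeBOPackageOn L χ S) :
    SoftTubeNoIntruderOn L χ S := by
  intro k ε hε
  have hL1 : (1 : ℝ) ≤ (L : ℝ) ^ 3 := one_le_pow₀ (by exact_mod_cast NeZero.one_le)
  obtain ⟨C1, B0, hONE⟩ := oneSiteLevels_proof k
  obtain ⟨θ, hθ, hθ1, βP, hPk⟩ := hP k ε hε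
  set τ : ℝ := θ / (2 * (|levelGap k| + |C1| + 2)) with hτ
  have hτ0 : 0 < τ := by rw [hτ]; positivity
  refine ⟨max (max 1 B0) (max βP (2 / τ ^ 3)), fun β hβ => ?_⟩
  have hβ1 : 1 ≤ β := ((le_max_left _ _).trans (le_max_left _ _)).trans hβ
  have hβ0 : 0 < β := by linarith
  have hβB0 : B0 ≤ β := ((le_max_right _ _).trans (le_max_left _ _)).trans hβ
  have hβP : βP ≤ β := ((le_max_left _ _).trans (le_max_right _ _)).trans hβ
  have hβτ : 2 / τ ^ 3 ≤ β := ((le_max_right _ _).trans (le_max_right _ _)).trans hβ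
  intro f hfm hfb hfs hfS hGram
  have hB'β : β ≤ (L : ℝ) ^ 3 * β := by nlinarith
  have hB'0 : 0 < (L : ℝ) ^ 3 * β := lt_of_lt_of_le hβ0 hB'β
  obtain ⟨hμ0, -, hμk⟩ := hONE ((L : ℝ) ^ 3 * β) (hβB0.trans hB'β)
  set lam := bareLambda ((L : ℝ) ^ 3 * β) with hlamdef
  have hlam0 : 0 < lam := bareLambda_pos' hB'0
  have hlamτ : lam ≤ τ := bareLambda_cube_le (L := L) hτ0 hβτ
  have hτle : τ ≤ 1 / (2 * (|levelGap k| + |C1| + 2)) := by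
    rw [hτ]; exact div_le_div_of_nonneg_right hθ1 (by positivity)
  obtain ⟨-, -, hy⟩ := smallness_of_le hlam0.le (hlamτ.trans hτle)
  have hμk' : Real.exp (-(levelGap k * lam + |C1| * lam ^ 2)) * levelValue su2Rep 1 ((L : ℝ) ^ 3 * β) 0 ≤
      levelValue su2Rep 1 ((L : ℝ) ^ 3 * β) k := by
    refine le_trans (mul_le_mul_of_nonneg_right (Real.exp_le_exp.2 ?_) hμ0.le) hμk
    have := mul_le_mul_of_nonneg_right (le_abs_self C1) (sq_nonneg lam)
    linarith
  have hμk2 := half_le_of_exp_lower hy hμ0.le hμk'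
  have hyθ : levelGap k * lam + |C1| * lam ^ 2 ≤ θ / 2 := by
    have hlam1 : lam ≤ 1 := by
      have : τ ≤ 1 / (2 * 2) := hτle.trans (by
        apply div_le_div_of_nonneg_left (by norm_num) (by norm_num)
        nlinarith [abs_nonneg (levelGap k), abs_nonneg C1])
      linarith
    have h1 : levelGap k * lam ≤ |levelGap k| * lam := mul_le_mul_of_nonneg_right (le_abs_self _) hlam0.le
    have h2 : |C1| * lam ^ 2 ≤ |C1| * lam := by
      refine mul_le_mul_of_nonneg_left ?_ (abs_nonneg _); nlinarith
    have h3 : (|levelGap k| + |C1|) * lam ≤ (|levelGap k| + |C1|) * τ := mul_le_mul_of_nonneg_left hlamτ (by positivity)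
    have h4 : (|levelGap k| + |C1|) * τ ≤ θ / 2 := by
      rw [hτ]
      have hpos : 0 < 2 * (|levelGap k| + |C1| + 2) := by positivity
      rw [mul_div_assoc', div_le_iff₀ hpos]
      nlinarith [abs_nonneg (levelGap k), abs_nonneg C1]
    linarith
  have hμkθ : (1 - θ / 2) * levelValue su2Rep 1 ((L : ℝ) ^ 3 * β) 0 ≤ levelValue su2Rep 1 ((L : ℝ) ^ 3 * β) k := by
    refine le_trans (mul_le_mul_of_nonneg_right ?_ hμ0.le) hμk'
    have := Real.add_one_le_exp (-(levelGap k * lam + |C1| * lam ^ 2))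
    linarith
  obtain ⟨σ, b, hσ, -, hb2, hfloor, hsplit⟩ := hPk β hβP
  obtain ⟨u, v, hall, a, ha, huu⟩ := hsplit f hfm hfb hfs hfS hGram
  obtain ⟨hNu, hNv, hN, hvv, hQ⟩ := hall a
  refine ⟨a, ha, ?_⟩
  exact feshbach_endgame hε.le hlam0.le hσ.le hθ hμ0.le hμk2 hμkθ hNu hNv hN hb2 hfloor hvv hQ huu

/-- ★★★ **C4 INNER ONE-ORBIT ⇐ the support-separated package for an admissible weight.** [cite: Luscher1983, §3] -/
theorem innerNoIntruderOneOrbitAt_of_softTubePackageOn {δ : ℝ → ℝ} {χ : ℝ → GaugeConfig 3 L SU2 → ℝ} (hT : SoftTubeAdmissible L δ χ)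
    (hP : SoftTubeBOPackageOn L χ (fun β => {U | orbitDist U < δ β})) : InnerNoIntruderOneOrbitAt L δ :=
  innerNoIntruderOneOrbitAt_of_softTubeOn hT (softTubeNoIntruderOn_of_package hP)

/-! ## §4 ★★★ The instance of record: the BIG record weight, test functions in the small core -/

/-- ★★★ **C4-CORE ⇐ the package for `χ_big = recordWeightRho δ' ρ δg` (`δ ≤ δ'`, `2δ' ≤ ρ`, all positive) with test functions supported in `{orbitDist < δ}`.**
[cite: Luscher1983, §3] -/
theorem innerNoIntruderOneOrbitAt_of_bigRecordWeight_packageOn {δ δ' ρ δg : ℝ → ℝ} (hδ : ∀ β, 0 < δ β) (hδδ' : ∀ β, δ β ≤ δ' β) (hρ : ∀ β, 2 * δ' β ≤ ρ β)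
    (hP : SoftTubeBOPackageOn L (recordWeightRho L δ' ρ δg) (fun β => {U | orbitDist U < δ β})) : InnerNoIntruderOneOrbitAt L δ :=
  innerNoIntruderOneOrbitAt_of_softTubePackageOn
    (softTubeAdmissible_mono hδδ' (softTubeAdmissible_recordWeightRho L (fun β => (hδ β).trans_le (hδδ' β)) hρ)) hP

/-- ★★★ The power-scale form: core `β^{-s}`, weight radius `3β^{-s}`, fat radius `Mβ^{-s}` (`M ≥ 6`), gauge width `β^{-t}`. [cite: Luscher1983, §3] -/
theorem innerNoIntruderOneOrbitAt_pow_of_bigRecordWeight_packageOn (s t M : ℝ) (hM : 6 ≤ M)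
    (hP : SoftTubeBOPackageOn L (recordWeightRho L (fun β => 3 * powScale s β) (fun β => M * powScale s β) (powScale t))
      (fun β => {U | orbitDist U < powScale s β})) : InnerNoIntruderOneOrbitAt L (powScale s) :=
  innerNoIntruderOneOrbitAt_of_bigRecordWeight_packageOn (fun β => powScale_pos s β)
    (fun β => by linarith [powScale_pos s β]) (fun β => by nlinarith [powScale_pos s β]) hP

end Summit.QuantumFields.YangMills.Theorems.FemtoTransferGap

end
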